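import Summits.KontsevichZagierPeriods.KontsevichZagierPeriods.Theorems.RootDecompRelativeModAbsoluteRegFoldingDegOneP14
import Summits.KontsevichZagierPeriods.KontsevichZagierPeriods.Theorems.RootDecompRelativeModAbsoluteRegKernelPairLeOneP03

/-!
# `RegKernelPairDegOne` ⟺ its ONE-CYLINDER form (route `RootDecompRelativeModAbsolute`, support item
stmt-KontsevichZagierPeriods-30572) — the certified translation

Cell `decomp-kz`, lens 3 (decomp-kz-lens-3 g9), §19.  `CylKernelZero` is the statement that ONE 2-dimensional
representation on a cylinder `P × (0,1)` whose integrand is a regularised family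
`a₀(x) + Σᵢ cᵢ(x) θ^{Mᵢ}/(1 + θ^{eᵢ} κᵢ(x))` (`ℚ`-semialgebraic data, `eᵢ ∈ {1,2}`, `κᵢ > −1`, the usual
integrability side conditions) with a.e.-VANISHING fibre integrals is a Kontsevich–Zagier relation.  INLINE VARIANT (no Prop-valued `def`; the one-cylinder form is spelled out in each statement). We prove
`regKernelPairDegOne_iff_cylKernelZero : RegKernelPairDegOne ↔ (one-cylinder form)` (item 30572 BY NAME):
(⇐) is the generic reduction used by every rung of the lineage (collapse each side to one representation by
integrand additivity, fold the unfolded bases, split the bases into `G ∩ G'`, `G ∖ G'`, `G' ∖ G` by domain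
additivity, subtract on the common piece, read the three pieces as one-cylinder families — on `G ∩ G'` the
concatenated family `(h, −h')` via `Fin.append`); (⇒) is the special case `G' = G`, `g' = 0`, `k' = 0`.
Consequence for the route: every further rung of 30572 (and the item itself) is exactly a statement about ONE
regularised family on ONE cylinder with zero fibre integrals; the four proved rungs (k+k' ≤ 1, common log,
common arctan, common κ₀ > 0 with both kinds) are its instances with ≤ 1 resp. one common argument function.

Imports only LANDED modules (the RegFoldingDegOne chain P14 and RegKernelPairLeOne P03); the two helpers it
needs from the not-yet-landed parts P06/P11 are inlined under fresh names (`of_sub_sub_sum_mem_relations₀`,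
`isSemialgebraicFunOn_cyl_monomial`).  Source: `HOME/decomp-kz-lens-3/g9/CylKernelZeroEquiv.lean` (this text).
No `sorry`; standard axioms.  References: [cite: KontsevichZagier2001, §1.2 rules (1)]; Bochnak–Coste–Roy 1998 §2.9.
LANDING SPLIT (lander-1 g2; unsplit source sha256 584099badd18065a, text verbatim): part 1/2 = helpers (PRIVATE,
no `dedup.landed` twins with the parallel parts P06/P11) + `regKernelPairDegOne_of_cylKernelZero`; part 2/2 = converse + `iff`.
-/
noncomputable section

open Set MeasureTheory Filter Topology
open scoped BigOperators
open Literature.NumberTheory.Transcendental Literature.ModelTheory.ExponentialFields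
namespace Summit.KontsevichZagierPeriods.RootDecompRelativeModAbsolute.Rung30571
namespace RegularisedLogLayer

section CylKernelZeroHelpers

/-- Finite sums of `ℚ`-semialgebraic functions are `ℚ`-semialgebraic (local copy: the landed twin is
`private` in the chain modules). [BCR 1998, Prop. 2.2.6] -/
private theorem isSemialgebraicFunOn_finset_sum₀ {n : ℕ} {s : Set (Fin n → ℝ)} (hs : IsSemialgebraic ℚ s)
    {ι : Type*} (I : Finset ι) {f : ι → (Fin n → ℝ) → ℝ}
    (hf : ∀ i ∈ I, IsSemialgebraicFunOn ℚ s (f i)) :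
    IsSemialgebraicFunOn ℚ s (fun x => ∑ i ∈ I, f i x) := by
  classical
  induction I using Finset.induction_on with
  | empty => exact (isSemialgebraicFunOn_ratCast hs 0).congr fun x _ => by simp
  | insert a I ha ih =>
    have h1 : IsSemialgebraicFunOn ℚ s (f a) := hf a (Finset.mem_insert_self a I)
    have h2 := ih fun i hi => hf i (Finset.mem_insert_of_mem hi)
    refine (IsSemialgebraicFunOn.add_holds h1 h2).congr fun x _ => ?_
    simp only [Pi.add_apply, Finset.sum_insert ha]

/-- **Integrand additivity for a finite family on a common domain.** [KZ 2001, §1.2 rule (1)] -/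
private theorem of_sub_sub_sum_mem_relations₀ {m : ℕ} (k : ℕ) :
    ∀ (V r₀ : KZ.IntegralRep m) (r : Fin k → KZ.IntegralRep m),
      r₀.domain = V.domain → (∀ i, (r i).domain = V.domain) →
      EqOn V.integrand (fun x => r₀.integrand x + ∑ i, (r i).integrand x) V.domain →
      KZ.of V - KZ.of r₀ - ∑ i, KZ.of (r i) ∈ KZ.relations := by
  classical
  induction k with
  | zero =>
    intro V r₀ r h0 hr hV
    simp only [Finset.univ_eq_empty, Finset.sum_empty, sub_zero, add_zero] at hV ⊢
    refine AECongr.of_sub_of_mem_relations_of_indicator_ae V r₀ (ae_of_all _ fun x => ?_)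
    rw [h0]
    by_cases hx : x ∈ V.domain
    · rw [indicator_of_mem hx, indicator_of_mem hx, hV hx]
    · rw [indicator_of_notMem hx, indicator_of_notMem hx]
  | succ k ih =>
    intro V r₀ r h0 hr hV
    have hD : IsSemialgebraic ℚ V.domain := V.isSemialgebraic_domain
    have hs0 : IsSemialgebraicFunOn ℚ V.domain r₀.integrand := by
      rw [← h0]; exact r₀.isSemialgebraicFunOn_integrand
    have hsi : ∀ i, IsSemialgebraicFunOn ℚ V.domain (r i).integrand := by
      intro i; rw [← hr i]; exact (r i).isSemialgebraicFunOn_integrand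
    have hi0 : IntegrableOn r₀.integrand V.domain := by
      rw [← h0]; exact r₀.integrableOn
    have hii : ∀ i, IntegrableOn (r i).integrand V.domain := by
      intro i; rw [← hr i]; exact (r i).integrableOn
    let V' : KZ.IntegralRep m :=
      ⟨V.domain, fun x => r₀.integrand x + ∑ i : Fin k, (r (Fin.castSucc i)).integrand x, hD,
        IsSemialgebraicFunOn.add_holds hs0
          (isSemialgebraicFunOn_finset_sum₀ hD _ fun i _ => hsi (Fin.castSucc i)),
        hi0.add (integrable_finsetSum _ fun i _ => hii (Fin.castSucc i))⟩
    have h1 := ih V' r₀ (fun i => r (Fin.castSucc i)) h0 (fun i => hr _) (fun x _ => rfl)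
    have h2 : KZ.of V - KZ.of V' - KZ.of (r (Fin.last k)) ∈ KZ.integrandAddRel := by
      refine ⟨m, V, V', r (Fin.last k), rfl, hr _, fun x hx => ?_, rfl⟩
      show V.integrand x = (r₀.integrand x + ∑ i : Fin k, (r (Fin.castSucc i)).integrand x) +
          (r (Fin.last k)).integrand x
      rw [hV hx]
      dsimp only
      rw [Fin.sum_univ_castSucc]
      ring
    have e : KZ.of V - KZ.of r₀ - ∑ i, KZ.of (r i) =
        (KZ.of V - KZ.of V' - KZ.of (r (Fin.last k))) +
          (KZ.of V' - KZ.of r₀ - ∑ i : Fin k, KZ.of (r (Fin.castSucc i))) := by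
      rw [Fin.sum_univ_castSucc]; abel
    rw [e]
    exact add_mem (KZ.integrandAddRel_subset_relations h2) h1

end CylKernelZeroHelpers

section CylKernelZeroEquiv

/-- **Item 30572 follows from its one-cylinder form** (the generic reduction behind §16–§18: collapse
each side to ONE representation (rule 1b, Σ-version), fold the unfolded bases, split the bases into
`G ∩ G'`, `G ∖ G'`, `G' ∖ G` (rule 1a), subtract on the common piece (rule 1b), and read the three
pieces as one-cylinder families — on `G ∩ G'` the concatenated family `(h, −h')`). [KZ 2001 §1.2
rules (1); folklore] -/
theorem regKernelPairDegOne_of_cylKernelZero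
    (hC : (∀ (P : Set (Fin 1 → ℝ)) (V : KZ.IntegralRep (1 + 1)) (a₀ : (Fin 1 → ℝ) → ℝ) (q : ℕ)
        (c κ : Fin q → (Fin 1 → ℝ) → ℝ) (M e : Fin q → ℕ),
        IsSemialgebraic ℚ P → IsSemialgebraicFunOn ℚ P a₀ → IntegrableOn a₀ P →
        (∀ i, IsSemialgebraicFunOn ℚ P (c i)) → (∀ i, IsSemialgebraicFunOn ℚ P (κ i)) →
        (∀ i, e i = 1 ∨ e i = 2) → (∀ i, ∀ x ∈ P, -1 < κ i x) →
        (∀ i, IntegrableOn (fun z : Fin (1 + 1) → ℝ =>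
          c i (Fin.init z) * (z (Fin.last 1) ^ M i / (1 + z (Fin.last 1) ^ e i * κ i (Fin.init z))))
          {z : Fin (1 + 1) → ℝ | (Fin.init z : Fin 1 → ℝ) ∈ P ∧ z (Fin.last 1) ∈ Set.Ioo 0 1}) →
        (∀ i, IntegrableOn (fun x => c i x * ∫ θ in Set.Ioo (0 : ℝ) 1, θ ^ M i / (1 + θ ^ e i * κ i x)) P) →
        V.domain = {z : Fin (1 + 1) → ℝ | (Fin.init z : Fin 1 → ℝ) ∈ P ∧ z (Fin.last 1) ∈ Set.Ioo 0 1} →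
        Set.EqOn V.integrand (fun z => a₀ (Fin.init z) +
          ∑ i, c i (Fin.init z) * (z (Fin.last 1) ^ M i / (1 + z (Fin.last 1) ^ e i * κ i (Fin.init z))))
          V.domain →
        (∀ᵐ x : (Fin 1 → ℝ), x ∈ P →
          a₀ x + ∑ i, c i x * ∫ θ in Set.Ioo (0 : ℝ) 1, θ ^ M i / (1 + θ ^ e i * κ i x) = 0) →
        KZ.of V ∈ KZ.relations)) :
    Summit.KontsevichZagierPeriods.KontsevichZagierPeriods.Theses.RootDecompRelativeModAbsolute.RegKernelPairDegOne := by
  intro g g' k k' h κ M e U h' κ' M' e' U' hh hκs hem hκ1 hdom hint hL1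
    hh' hκs' hem' hκ1' hdom' hint' hL1' hae
  classical
  -- the pieces of the bases
  have hG : IsSemialgebraic ℚ g.domain := g.isSemialgebraic_domain
  have hG' : IsSemialgebraic ℚ g'.domain := g'.isSemialgebraic_domain
  have hIs : IsSemialgebraic ℚ (g.domain ∩ g'.domain) := hG.inter hG'
  have hDs : IsSemialgebraic ℚ (g.domain \ g'.domain) := hG.diff hG'
  have hD's : IsSemialgebraic ℚ (g'.domain \ g.domain) := hG'.diff hG
  -- the collapsed integrands
  set FU : (Fin (1 + 1) → ℝ) → ℝ := fun z =>
    ∑ i, h i (Fin.init z) * (z (Fin.last 1) ^ M i / (1 + z (Fin.last 1) ^ e i * κ i (Fin.init z)))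
    with hFU_def
  set FU' : (Fin (1 + 1) → ℝ) → ℝ := fun z =>
    ∑ j, h' j (Fin.init z) * (z (Fin.last 1) ^ M' j / (1 + z (Fin.last 1) ^ e' j * κ' j (Fin.init z)))
    with hFU'_def
  have hcyl : IsSemialgebraic ℚ (RTerm.cyl g.domain) := RTerm.isSemialgebraic_cyl hG
  have hcyl' : IsSemialgebraic ℚ (RTerm.cyl g'.domain) := RTerm.isSemialgebraic_cyl hG'
  have hcylm : MeasurableSet (RTerm.cyl g.domain) := hcyl.measurableSet_holds
  have hcylm' : MeasurableSet (RTerm.cyl g'.domain) := hcyl'.measurableSet_holds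
  have hUpt : ∀ i, ∀ z ∈ RTerm.cyl g.domain, (U i).integrand z =
      h i (Fin.init z) * (z (Fin.last 1) ^ M i / (1 + z (Fin.last 1) ^ e i * κ i (Fin.init z))) :=
    fun i z hz => hint i (by rw [hdom i]; exact hz)
  have hU'pt : ∀ j, ∀ z ∈ RTerm.cyl g'.domain, (U' j).integrand z =
      h' j (Fin.init z) * (z (Fin.last 1) ^ M' j / (1 + z (Fin.last 1) ^ e' j * κ' j (Fin.init z))) :=
    fun j z hz => hint' j (by rw [hdom' j]; exact hz)
  have hU_sa : ∀ i, IsSemialgebraicFunOn ℚ (RTerm.cyl g.domain) (fun z =>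
      h i (Fin.init z) * (z (Fin.last 1) ^ M i / (1 + z (Fin.last 1) ^ e i * κ i (Fin.init z)))) := by
    intro i
    have h1 := (U i).isSemialgebraicFunOn_integrand
    rw [hdom i] at h1
    exact h1.congr fun z hz => hUpt i z hz
  have hU'_sa : ∀ j, IsSemialgebraicFunOn ℚ (RTerm.cyl g'.domain) (fun z =>
      h' j (Fin.init z) * (z (Fin.last 1) ^ M' j / (1 + z (Fin.last 1) ^ e' j * κ' j (Fin.init z)))) := by
    intro j
    have h1 := (U' j).isSemialgebraicFunOn_integrand
    rw [hdom' j] at h1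
    exact h1.congr fun z hz => hU'pt j z hz
  have hU_int : ∀ i, IntegrableOn (fun z =>
      h i (Fin.init z) * (z (Fin.last 1) ^ M i / (1 + z (Fin.last 1) ^ e i * κ i (Fin.init z))))
      (RTerm.cyl g.domain) := by
    intro i
    have h1 := (U i).integrableOn
    rw [hdom i] at h1
    exact h1.congr_fun (fun z hz => hUpt i z hz) hcylm
  have hU'_int : ∀ j, IntegrableOn (fun z =>
      h' j (Fin.init z) * (z (Fin.last 1) ^ M' j / (1 + z (Fin.last 1) ^ e' j * κ' j (Fin.init z))))
      (RTerm.cyl g'.domain) := by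
    intro j
    have h1 := (U' j).integrableOn
    rw [hdom' j] at h1
    exact h1.congr_fun (fun z hz => hU'pt j z hz) hcylm'
  -- the unfolded bases and the collapsed representations `V`, `V'`
  have hg_sa : IsSemialgebraicFunOn ℚ (RTerm.cyl g.domain) (fun z => g.integrand (Fin.init z)) :=
    g.isSemialgebraicFunOn_integrand.comp_init_mono hcyl fun z hz => hz.1
  have hg'_sa : IsSemialgebraicFunOn ℚ (RTerm.cyl g'.domain) (fun z => g'.integrand (Fin.init z)) :=
    g'.isSemialgebraicFunOn_integrand.comp_init_mono hcyl' fun z hz => hz.1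
  have hg_int : IntegrableOn (fun z : Fin (1 + 1) → ℝ => g.integrand (Fin.init z))
      (RTerm.cyl g.domain) := by
    have := integrableOn_cyl_polynomial hG (m := 0) (a := fun _ => g.integrand)
      (fun _ => g.isSemialgebraicFunOn_integrand) (fun _ => g.integrableOn)
    exact this.congr_fun (fun z _ => by simp) hcylm
  have hg'_int : IntegrableOn (fun z : Fin (1 + 1) → ℝ => g'.integrand (Fin.init z))
      (RTerm.cyl g'.domain) := by
    have := integrableOn_cyl_polynomial hG' (m := 0) (a := fun _ => g'.integrand)
      (fun _ => g'.isSemialgebraicFunOn_integrand) (fun _ => g'.integrableOn)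
    exact this.congr_fun (fun z _ => by simp) hcylm'
  let B₀ : KZ.IntegralRep (1 + 1) :=
    ⟨RTerm.cyl g.domain, fun z => g.integrand (Fin.init z), hcyl, hg_sa, hg_int⟩
  let B₀' : KZ.IntegralRep (1 + 1) :=
    ⟨RTerm.cyl g'.domain, fun z => g'.integrand (Fin.init z), hcyl', hg'_sa, hg'_int⟩
  have hFU_sa : IsSemialgebraicFunOn ℚ (RTerm.cyl g.domain) FU := by
    simp only [hFU_def]
    exact isSemialgebraicFunOn_finset_sum₀ hcyl _ fun i _ => hU_sa i
  have hFU'_sa : IsSemialgebraicFunOn ℚ (RTerm.cyl g'.domain) FU' := by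
    simp only [hFU'_def]
    exact isSemialgebraicFunOn_finset_sum₀ hcyl' _ fun j _ => hU'_sa j
  have hFU_int : IntegrableOn FU (RTerm.cyl g.domain) := by
    simp only [hFU_def]
    exact integrable_finsetSum _ fun i _ => hU_int i
  have hFU'_int : IntegrableOn FU' (RTerm.cyl g'.domain) := by
    simp only [hFU'_def]
    exact integrable_finsetSum _ fun j _ => hU'_int j
  let V : KZ.IntegralRep (1 + 1) :=
    ⟨RTerm.cyl g.domain, fun z => g.integrand (Fin.init z) + FU z, hcyl,
      IsSemialgebraicFunOn.add_holds hg_sa hFU_sa, hg_int.add hFU_int⟩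
  let V' : KZ.IntegralRep (1 + 1) :=
    ⟨RTerm.cyl g'.domain, fun z => g'.integrand (Fin.init z) + FU' z, hcyl',
      IsSemialgebraicFunOn.add_holds hg'_sa hFU'_sa, hg'_int.add hFU'_int⟩
  -- (A) collapse: `[V] ≡ [B₀] + Σ [Uᵢ]`, `[B₀] ≡ [g]`
  have hA : KZ.of V - KZ.of B₀ - ∑ i, KZ.of (U i) ∈ KZ.relations := by
    refine of_sub_sub_sum_mem_relations₀ k V B₀ U rfl (fun i => hdom i) fun z hz => ?_
    show g.integrand (Fin.init z) + FU z = g.integrand (Fin.init z) + ∑ i, (U i).integrand z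
    simp only [hFU_def]
    congr 1
    exact Finset.sum_congr rfl fun i _ => (hUpt i z hz).symm
  have hA' : KZ.of V' - KZ.of B₀' - ∑ j, KZ.of (U' j) ∈ KZ.relations := by
    refine of_sub_sub_sum_mem_relations₀ k' V' B₀' U' rfl (fun j => hdom' j) fun z hz => ?_
    show g'.integrand (Fin.init z) + FU' z = g'.integrand (Fin.init z) + ∑ j, (U' j).integrand z
    simp only [hFU'_def]
    congr 1
    exact Finset.sum_congr rfl fun j _ => (hU'pt j z hz).symm
  have hB₀ : KZ.of B₀ - KZ.of g ∈ KZ.relations := by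
    obtain ⟨hTb, hfold⟩ := foldsTo_cyl_polynomial B₀ hG (m := 0) (a := fun _ => g.integrand)
      (fun _ => g.isSemialgebraicFunOn_integrand) rfl (fun z _ => by
        show g.integrand (Fin.init z) = _
        simp)
    have h1 : KZ.of B₀ - KZ.of (RTerm.baseRep _ hTb) ∈ KZ.relations := by
      have := hfold.1
      rwa [RTerm.unfold_base] at this
    have h2 : KZ.of (RTerm.baseRep _ hTb) - KZ.of g ∈ KZ.relations := by
      refine AECongr.of_sub_of_mem_relations_of_indicator_ae _ g (ae_of_all _ fun x => ?_)
      show g.domain.indicator (fun x => ∑ k : Fin (0 + 1), g.integrand x / ((k : ℕ) + 1)) x =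
        g.domain.indicator g.integrand x
      congr 1
      funext y
      simp
    have e : KZ.of B₀ - KZ.of g = (KZ.of B₀ - KZ.of (RTerm.baseRep _ hTb)) +
        (KZ.of (RTerm.baseRep _ hTb) - KZ.of g) := by abel
    rw [e]
    exact add_mem h1 h2
  have hB₀' : KZ.of B₀' - KZ.of g' ∈ KZ.relations := by
    obtain ⟨hTb, hfold⟩ := foldsTo_cyl_polynomial B₀' hG' (m := 0) (a := fun _ => g'.integrand)
      (fun _ => g'.isSemialgebraicFunOn_integrand) rfl (fun z _ => by
        show g'.integrand (Fin.init z) = _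
        simp)
    have h1 : KZ.of B₀' - KZ.of (RTerm.baseRep _ hTb) ∈ KZ.relations := by
      have := hfold.1
      rwa [RTerm.unfold_base] at this
    have h2 : KZ.of (RTerm.baseRep _ hTb) - KZ.of g' ∈ KZ.relations := by
      refine AECongr.of_sub_of_mem_relations_of_indicator_ae _ g' (ae_of_all _ fun x => ?_)
      show g'.domain.indicator (fun x => ∑ k : Fin (0 + 1), g'.integrand x / ((k : ℕ) + 1)) x =
        g'.domain.indicator g'.integrand x
      congr 1
      funext y
      simp
    have e : KZ.of B₀' - KZ.of g' = (KZ.of B₀' - KZ.of (RTerm.baseRep _ hTb)) +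
        (KZ.of (RTerm.baseRep _ hTb) - KZ.of g') := by abel
    rw [e]
    exact add_mem h1 h2
  -- (B) domain splits along `G ∩ G'`, `G ∖ G'`, `G' ∖ G`
  have hIsub : RTerm.cyl (g.domain ∩ g'.domain) ⊆ RTerm.cyl g.domain := fun z hz => ⟨hz.1.1, hz.2⟩
  have hIsub' : RTerm.cyl (g.domain ∩ g'.domain) ⊆ RTerm.cyl g'.domain := fun z hz => ⟨hz.1.2, hz.2⟩
  have hDsub : RTerm.cyl (g.domain \ g'.domain) ⊆ RTerm.cyl g.domain := fun z hz => ⟨hz.1.1, hz.2⟩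
  have hD'sub : RTerm.cyl (g'.domain \ g.domain) ⊆ RTerm.cyl g'.domain := fun z hz => ⟨hz.1.1, hz.2⟩
  have hcI : IsSemialgebraic ℚ (RTerm.cyl (g.domain ∩ g'.domain)) := RTerm.isSemialgebraic_cyl hIs
  have hcD : IsSemialgebraic ℚ (RTerm.cyl (g.domain \ g'.domain)) := RTerm.isSemialgebraic_cyl hDs
  have hcD' : IsSemialgebraic ℚ (RTerm.cyl (g'.domain \ g.domain)) := RTerm.isSemialgebraic_cyl hD's
  let V₁ : KZ.IntegralRep (1 + 1) := V.restrict _ hcI hIsub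
  let V₂ : KZ.IntegralRep (1 + 1) := V.restrict _ hcD hDsub
  let V'₁ : KZ.IntegralRep (1 + 1) := V'.restrict _ hcI hIsub'
  let V'₂ : KZ.IntegralRep (1 + 1) := V'.restrict _ hcD' hD'sub
  have hS : KZ.of V - KZ.of V₁ - KZ.of V₂ ∈ KZ.relations := by
    refine KZ.domainAddRel_subset_relations ⟨_, V, V₁, V₂, ?_, ?_, fun _ _ => rfl, fun _ _ => rfl, rfl⟩
    · show RTerm.cyl g.domain =
        RTerm.cyl (g.domain ∩ g'.domain) ∪ RTerm.cyl (g.domain \ g'.domain)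
      ext z
      simp only [RTerm.cyl, mem_setOf_eq, mem_union, mem_inter_iff, Set.mem_sdiff]
      tauto
    · show volume (RTerm.cyl (g.domain ∩ g'.domain) ∩ RTerm.cyl (g.domain \ g'.domain)) = 0
      have h0 : RTerm.cyl (g.domain ∩ g'.domain) ∩ RTerm.cyl (g.domain \ g'.domain) = ∅ := by
        ext z
        simp only [RTerm.cyl, mem_setOf_eq, mem_inter_iff, Set.mem_sdiff, mem_empty_iff_false, iff_false]
        tauto
      rw [h0, measure_empty]
  have hS' : KZ.of V' - KZ.of V'₁ - KZ.of V'₂ ∈ KZ.relations := by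
    refine KZ.domainAddRel_subset_relations
      ⟨_, V', V'₁, V'₂, ?_, ?_, fun _ _ => rfl, fun _ _ => rfl, rfl⟩
    · show RTerm.cyl g'.domain =
        RTerm.cyl (g.domain ∩ g'.domain) ∪ RTerm.cyl (g'.domain \ g.domain)
      ext z
      simp only [RTerm.cyl, mem_setOf_eq, mem_union, mem_inter_iff, Set.mem_sdiff]
      tauto
    · show volume (RTerm.cyl (g.domain ∩ g'.domain) ∩ RTerm.cyl (g'.domain \ g.domain)) = 0
      have h0 : RTerm.cyl (g.domain ∩ g'.domain) ∩ RTerm.cyl (g'.domain \ g.domain) = ∅ := by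
        ext z
        simp only [RTerm.cyl, mem_setOf_eq, mem_inter_iff, Set.mem_sdiff, mem_empty_iff_false, iff_false]
        tauto
      rw [h0, measure_empty]
  -- (C) subtraction on the common piece
  let W : KZ.IntegralRep (1 + 1) :=
    ⟨RTerm.cyl (g.domain ∩ g'.domain), fun z => V.integrand z - V'.integrand z, hcI,
      IsSemialgebraicFunOn.sub_holds (V.isSemialgebraicFunOn_integrand.mono hIsub hcI)
        (V'.isSemialgebraicFunOn_integrand.mono hIsub' hcI),
      (V.integrableOn.mono_set hIsub).sub (V'.integrableOn.mono_set hIsub')⟩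
  have hW3 : KZ.of V₁ - KZ.of V'₁ - KZ.of W ∈ KZ.relations := by
    refine KZ.integrandAddRel_subset_relations ⟨_, V₁, V'₁, W, rfl, rfl, fun z _ => ?_, rfl⟩
    show V.integrand z = V'.integrand z + (V.integrand z - V'.integrand z)
    ring
  -- (D) the three pieces are relations (the one-cylinder form)
  have hW : KZ.of W ∈ KZ.relations := by
    refine hC (g.domain ∩ g'.domain) W (fun x => g.integrand x - g'.integrand x) (k + k')
      (Fin.append h (fun j x => -h' j x)) (Fin.append κ κ') (Fin.append M M') (Fin.append e e') hIs
      (IsSemialgebraicFunOn.sub_holds (g.isSemialgebraicFunOn_integrand.mono inter_subset_left hIs)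
        (g'.isSemialgebraicFunOn_integrand.mono inter_subset_right hIs))
      ((g.integrableOn.mono_set inter_subset_left).sub (g'.integrableOn.mono_set inter_subset_right))
      (fun i => ?_) (fun i => ?_) (fun i => ?_) (fun i => ?_) (fun i => ?_) (fun i => ?_) rfl
      (fun z _ => ?_) ?_
    · refine Fin.addCases (fun i => ?_) (fun j => ?_) i
      · simp only [Fin.append_left]; exact (hh i).mono inter_subset_left hIs
      · simp only [Fin.append_right]
        exact isSemialgebraicFunOn_neg' hIs ((hh' j).mono inter_subset_right hIs)
    · refine Fin.addCases (fun i => ?_) (fun j => ?_) i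
      · simp only [Fin.append_left]; exact (hκs i).mono inter_subset_left hIs
      · simp only [Fin.append_right]; exact (hκs' j).mono inter_subset_right hIs
    · refine Fin.addCases (fun i => ?_) (fun j => ?_) i
      · simp only [Fin.append_left]; exact hem i
      · simp only [Fin.append_right]; exact hem' j
    · refine Fin.addCases (fun i => ?_) (fun j => ?_) i
      · simp only [Fin.append_left]; exact fun x hx => hκ1 i x hx.1
      · simp only [Fin.append_right]; exact fun x hx => hκ1' j x hx.2
    · refine Fin.addCases (fun i => ?_) (fun j => ?_) i
      · simp only [Fin.append_left]; exact (hU_int i).mono_set hIsub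
      · simp only [Fin.append_right]
        exact ((hU'_int j).mono_set hIsub').neg.congr_fun (fun z _ => by
          simp only [Pi.neg_apply, neg_mul]) hcI.measurableSet_holds
    · refine Fin.addCases (fun i => ?_) (fun j => ?_) i
      · simp only [Fin.append_left]; exact (hL1 i).mono_set inter_subset_left
      · simp only [Fin.append_right]
        exact ((hL1' j).mono_set inter_subset_right).neg.congr_fun (fun x _ => by
          simp only [Pi.neg_apply, neg_mul]) hIs.measurableSet_holds
    · show (g.integrand (Fin.init z) + FU z) - (g'.integrand (Fin.init z) + FU' z) =
        (g.integrand (Fin.init z) - g'.integrand (Fin.init z)) +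
          ∑ i : Fin (k + k'), Fin.append h (fun j x => -h' j x) i (Fin.init z) *
            (z (Fin.last 1) ^ Fin.append M M' i /
              (1 + z (Fin.last 1) ^ Fin.append e e' i * Fin.append κ κ' i (Fin.init z)))
      rw [Fin.sum_univ_add]
      simp only [Fin.append_left, Fin.append_right, hFU_def, hFU'_def, neg_mul,
        Finset.sum_neg_distrib]
      ring
    · filter_upwards [hae] with x hx hxI
      simp only [indicator_of_mem hxI.1, indicator_of_mem hxI.2] at hx
      rw [Fin.sum_univ_add]
      simp only [Fin.append_left, Fin.append_right, neg_mul, Finset.sum_neg_distrib]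
      linarith
  have hV₂ : KZ.of V₂ ∈ KZ.relations := by
    refine hC (g.domain \ g'.domain) V₂ g.integrand k h κ M e hDs
      (g.isSemialgebraicFunOn_integrand.mono (fun x hx => hx.1) hDs)
      (g.integrableOn.mono_set fun x hx => hx.1)
      (fun i => (hh i).mono (fun x hx => hx.1) hDs) (fun i => (hκs i).mono (fun x hx => hx.1) hDs)
      hem (fun i x hx => hκ1 i x hx.1) (fun i => (hU_int i).mono_set hDsub)
      (fun i => (hL1 i).mono_set fun x hx => hx.1) rfl (fun z _ => rfl) ?_
    filter_upwards [hae] with x hx hxD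
    simp only [indicator_of_mem hxD.1, indicator_of_notMem hxD.2] at hx
    exact hx
  have hV'₂ : KZ.of V'₂ ∈ KZ.relations := by
    refine hC (g'.domain \ g.domain) V'₂ g'.integrand k' h' κ' M' e' hD's
      (g'.isSemialgebraicFunOn_integrand.mono (fun x hx => hx.1) hD's)
      (g'.integrableOn.mono_set fun x hx => hx.1)
      (fun j => (hh' j).mono (fun x hx => hx.1) hD's) (fun j => (hκs' j).mono (fun x hx => hx.1) hD's)
      hem' (fun j x hx => hκ1' j x hx.1) (fun j => (hU'_int j).mono_set hD'sub)
      (fun j => (hL1' j).mono_set fun x hx => hx.1) rfl (fun z _ => rfl) ?_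
    filter_upwards [hae] with x hx hxD
    simp only [indicator_of_notMem hxD.2, indicator_of_mem hxD.1] at hx
    exact hx.symm
  -- (E) assemble
  have eq : (KZ.of g + ∑ i, KZ.of (U i)) - (KZ.of g' + ∑ j, KZ.of (U' j)) =
      -(KZ.of V - KZ.of B₀ - ∑ i, KZ.of (U i)) - (KZ.of B₀ - KZ.of g)
      + (KZ.of V' - KZ.of B₀' - ∑ j, KZ.of (U' j)) + (KZ.of B₀' - KZ.of g')
      + (KZ.of V - KZ.of V₁ - KZ.of V₂) - (KZ.of V' - KZ.of V'₁ - KZ.of V'₂)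
      + (KZ.of V₁ - KZ.of V'₁ - KZ.of W) + KZ.of W + KZ.of V₂ - KZ.of V'₂ := by
    abel
  rw [eq]
  exact sub_mem (add_mem (add_mem (add_mem (sub_mem (add_mem (add_mem (add_mem (sub_mem
    (neg_mem hA) hB₀) hA') hB₀') hS) hS') hW3) hW) hV₂) hV'₂

end CylKernelZeroEquiv
end RegularisedLogLayer
end Summit.KontsevichZagierPeriods.RootDecompRelativeModAbsolute.Rung30571
end
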